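import Summits.QuantumFields.YangMills.Theorems.BalabanUVNodesN08GuardReadSet
import Literature.MathematicalPhysics.QuantumFieldTheory.Balaban1983to89.B12SmallFieldDomain259

/-!
# BalabanUVNodes ∕ N08 — READ SET OF THE (0.4) GUARD, INCIDENCE FORM: every coarse bond `c′ ≠ c` other than the ANTIPODAL bond `⟨c₊, ·⟩ → c₋` has an END bond (first or last of its
# straight segment) that NO loop word of `c` reads — the free slot the laundering theorems need, for all segments but `c`'s own (and the 2-block-torus antipode)

Track A, DAG node N08 ([Balaban1985UV3] Thm 1 p. 257 ∕ Thm 2 p. 272; averaging [Balaban1987RG1] (0.4) p. 253).  Cell `pub-ymgap`, seat `pub-ymgap-dag-n08-d` g47 (R529-ym job;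
SPEC memo `N08-HJ-M3-SPEC-g47.md` (M3b), §4 caveat); `--supports stmt-QuantumFields-19936` (helper).  Sequel of ✓p756298 `…N08GuardReadSet` (block form).

CONTENTS ([folklore] torus incidence + the block form; 0 `def`, 0 `sorry`): `dir_eq_of_shift_eq` (`y + e_ν = y + e_μ ⇒ ν = μ`, tori with ≥ 2 sites per direction),
`incidence_trichotomy` (for `c′ ≠ c`: the centre block of `c′` avoids both blocks of `c`, OR the target block does, OR `c′` is antipodal: `c′₋ = c₊ ∧ c′₊ = c₋`),
★★ `first_or_last_unread_of_ne` (for `c′ ≠ c` not antipodal: the first or the last bond of `c′` is read by no loop word of `c`), ★★ `segment_unread_of_not_incident` (a segment NOT incident to `c`'s end blocks is ENTIRELY unread) and `axialAvg_eq_of_not_incident` (so its straight transporter does not feel the read set: the shape one level up lives on the STAR of `c`, SPEC §2).  The antipodal case is REAL on the 2-block tori at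
the top of the standing range (there the whole antipodal segment is read — SPEC §4); below them (`3 ≤ sitesPerDir (j+1)`) it is vacuous, which (M3c) will use.
HONEST: count-neutral helper; hTop ∕ (a)′∀ ∕ hJ NOT proved; N08 NOT discharged; R3 ≠ d = 4 ∕ mass gap ∕ Clay.
-/

noncomputable section

namespace Summit.QuantumFields.YangMills.Theorems.BalabanUVNodesN08GuardReadSetIncidence

open Literature.MathematicalPhysics.QuantumFieldTheory.Balaban1983to89
open Literature.MathematicalPhysics.QuantumFieldTheory.Balaban1983to89.T4Continuum
open Literature.MathematicalPhysics.QuantumFieldTheory.Balaban1983to89.AveragingRT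
open Literature.MathematicalPhysics.QuantumFieldTheory.Balaban1983to89.BlockAveraging
open Summit.QuantumFields.YangMills.Theorems.BalabanUVNodesN08GuardReadSet (first_or_last_unread_of_blocks)

variable {P : Params} {k : ℕ}

/-- **`y + e_ν = y + e_μ ⇒ ν = μ`** on the cell's tori (at least two sites per direction: `1 ≠ 0` in `ZMod (sitesPerDir k)`, as in lit `B12SmallFieldDomain259.src_ne_tgt`). [folklore] -/
theorem dir_eq_of_shift_eq (y : Site P k) {ν μ : Fin P.d} (h : y.shift ν = y.shift μ) : ν = μ := by
  by_contra hne
  have h1 := congrFun h μ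
  simp only [Site.shift, Function.update_self, Function.update_of_ne (Ne.symm hne)] at h1
  have h2 : (1 : ZMod (P.sitesPerDir k)) = 0 := by
    calc (1 : ZMod (P.sitesPerDir k)) = (y μ + 1) - y μ := by ring
      _ = 0 := by rw [← h1, sub_self]
  exact one_ne_zero h2

/-- **INCIDENCE TRICHOTOMY**: for coarse bonds `c′ ≠ c`, either the centre block `c′₋` is neither `c₋` nor `c₊`, or the target block `c′₊` is neither, or `c′` is the ANTIPODAL bond
(`c′₋ = c₊` and `c′₊ = c₋` — possible only on a torus with 2 sites in direction `c.dir`). [folklore] -/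
theorem incidence_trichotomy (c c' : PBond P (k + 1)) (hne : c' ≠ c) :
    (c'.src ≠ c.src ∧ c'.src ≠ c.tgt) ∨ (c'.tgt ≠ c.src ∧ c'.tgt ≠ c.tgt) ∨ (c'.src = c.tgt ∧ c'.tgt = c.src) := by
  by_cases h1 : c'.src ≠ c.src ∧ c'.src ≠ c.tgt
  · exact Or.inl h1
  by_cases h2 : c'.tgt ≠ c.src ∧ c'.tgt ≠ c.tgt
  · exact Or.inr (Or.inl h2)
  right; right
  rw [not_and_or, not_not, not_not] at h1 h2
  have hst' := B12SmallFieldDomain259.src_ne_tgt c'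
  rcases h1 with hs | hs
  · -- `c′₋ = c₋`: then `c′₊ ≠ c₋`, so `c′₊ = c₊`, whence the same direction and `c′ = c`
    exfalso
    rcases h2 with ht | ht
    · exact hst' (hs.trans ht.symm)
    · have hdir : c'.dir = c.dir := by
        have : c'.src.shift c'.dir = c.src.shift c.dir := by
          show c'.tgt = c.tgt
          exact ht
        rw [hs] at this
        exact dir_eq_of_shift_eq c.src this
      apply hne
      cases c; cases c'
      simp only [PBond.mk.injEq]
      exact ⟨hs, hdir⟩
  · -- `c′₋ = c₊`: then `c′₊ ≠ c₊`, so `c′₊ = c₋` — the antipodal case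
    rcases h2 with ht | ht
    · exact ⟨hs, ht⟩
    · exact absurd (hs.symm ▸ ht) hst'.symm

/-- ★★ **EVERY OTHER, NON-ANTIPODAL SEGMENT HAS AN UNREAD END**: for `c′ ≠ c` with `¬(c′₋ = c₊ ∧ c′₊ = c₋)`, the FIRST or the LAST bond of the straight segment of `c′` is traversed by no
loop word of the (0.4) guard of `c` (standing range).  With ✓`…N08GuardReadSet.small_iff_of_read` ∕ `corr_congr_of_read` this is the free slot px8's
`…FreeSlot.map_withDensity_axialAvg_eq_smul_of_readSet` asks for, on every segment except `c`'s own. [cite: Balaban1987RG1, (0.4) p.253] -/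
theorem first_or_last_unread_of_ne (hk : k + 1 ≤ P.m + P.K) (c c' : PBond P (k + 1)) (hne : c' ≠ c)
    (hanti : ¬ (c'.src = c.tgt ∧ c'.tgt = c.src)) :
    (∀ (i : Idx P), ∀ s ∈ walk (emb c.src) (loopWord P.L c.dir (off i.1) i.2.1 i.2.2), s.bond ≠ line c' 0) ∨
      (∀ (i : Idx P), ∀ s ∈ walk (emb c.src) (loopWord P.L c.dir (off i.1) i.2.1 i.2.2), s.bond ≠ line c' (P.L - 1)) := by
  rcases incidence_trichotomy c c' hne with h | h | h
  · exact first_or_last_unread_of_blocks hk c c' (Or.inl h)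
  · exact first_or_last_unread_of_blocks hk c c' (Or.inr h)
  · exact absurd h hanti

/-- ★★ **A SEGMENT NOT INCIDENT TO `c`'s END BLOCKS IS ENTIRELY UNREAD**: if neither end block of `c″` is an end block of `c`, then NO bond `line c″ t` (`t < L`) of its straight
segment is traversed by a loop word of the guard of `c` (each such bond issues from `B(c″₋)` or `B(c″₊)`, lit `AveragingRT.blockOf_lineSite`).  Hence, one level up, the coarse
variable `Ū(c″) = axialAvg U c″` of every bond NOT INCIDENT to `c₋, c₊` is untouched by a firing at `c`: the shape lives on the STAR of `c` (the `4d − 1` bonds incident to `c₋` or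
`c₊`; SPEC §2). [cite: Balaban1987RG1, (0.4) p.253] -/
theorem segment_unread_of_not_incident (hk : k + 1 ≤ P.m + P.K) (c c'' : PBond P (k + 1))
    (hs : c''.src ≠ c.src ∧ c''.src ≠ c.tgt) (ht : c''.tgt ≠ c.src ∧ c''.tgt ≠ c.tgt) {t : ℕ} (htL : t < P.L) :
    ∀ (i : Idx P), ∀ s ∈ walk (emb c.src) (loopWord P.L c.dir (off i.1) i.2.1 i.2.2), s.bond ≠ line c'' t := by
  refine BalabanUVNodesN08GuardReadSet.ne_of_blockOf_src_ne hk c ?_ ?_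
  · show blockOf (lineSite c'' t) ≠ c.src
    rcases blockOf_lineSite hk c'' htL with h | h
    · rw [h]; exact hs.1
    · rw [h]; exact ht.1
  · show blockOf (lineSite c'' t) ≠ c.tgt
    rcases blockOf_lineSite hk c'' htL with h | h
    · rw [h]; exact hs.2
    · rw [h]; exact ht.2

/-- ★ **Consequently the straight transporter of a non-incident bond does not feel the read set**: if `U = U′` off the bonds read by the guard of `c` … stated as: if `U` and `U′`
DIFFER only on bonds read by `c`'s loop words, then `axialAvg U c″ = axialAvg U′ c″` for every `c″` not incident to `c₋, c₊`. [cite: Balaban1984PropagatorsI, (1.7) p.18] -/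
theorem axialAvg_eq_of_not_incident (hk : k + 1 ≤ P.m + P.K) {G : Type*} [GaugeGroup G] {U U' : GaugeField P k G} (c c'' : PBond P (k + 1))
    (hs : c''.src ≠ c.src ∧ c''.src ≠ c.tgt) (ht : c''.tgt ≠ c.src ∧ c''.tgt ≠ c.tgt)
    (hUU' : ∀ b : PBond P k, (∀ (i : Idx P), ∀ s ∈ walk (emb c.src) (loopWord P.L c.dir (off i.1) i.2.1 i.2.2), s.bond ≠ b) → U b = U' b) :
    axialAvg U c'' = axialAvg U' c'' :=
  BalabanUVNodesN08GuardReadSet.axialAvg_congr_of_read_line c'' fun t htL =>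
    hUU' (line c'' t) (segment_unread_of_not_incident hk c c'' hs ht htL)

end Summit.QuantumFields.YangMills.Theorems.BalabanUVNodesN08GuardReadSetIncidence

end
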